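/-
Copyright (c) 2026 the pub-hodgecm-mathlib formalisation cell (harness21).  Prover seat hodgecm-mathlib-LH4-p05 (g3), req620 Track A «(D-RAM) FOUR-FRAME» squad
(unit U3_Laws, (R-18) «K-ABS-R := NI2 ⊕ KMS»; (KMS) ROAD «MODULO κ-STAGE B», κ-Stage A₂ brick (Oκ2b)-MULT = the κ-twist of LH4-p14 (g2)'s (O2b)-MULT (★ M1 p856360,
M2 p856385); (R-21) re-key; dealer LH4-plan (g11) WORD #20∕#21∕#29; plan `F0/P3c/LH4/LH4-p05/g3/PLAN-KMS-modKappaStageB.v1`).  2026-09-04.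
-/
import Summits.HodgeConjecture.HodgeConjecture.Theorems.F0P3cDyRamDiagonalOrbitFibreCountMult     -- ★ M1 p856360 (LH4-p14): the (O2b)-MULT pieces (slice counts of `Ω`, index identities); brings ★ PARTS 1–3
import Summits.HodgeConjecture.HodgeConjecture.Theorems.F0P3cDyRamDiagonalKappaOrbitFibreCount   -- (this seat): §1 `sum_signChar_filter_good_eq_card_mul_cosetKappa`; brings the DEFS leaf, `…KappaCountEval`
import Mathlib.Tactic.LinearCombination
import HarnessLib

/-!
# Crux `H413`, line LH4 «(D-RAM) FOUR-FRAME» road — unit U3_Laws (iii), (KMS) ROAD «MODULO κ-STAGE B», κ-STAGE A₂ brick (Oκ2b)-MULT: THE κ-TWISTED FIBRE COUNT ALONG A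
# UNIT-TORUS ORBIT WITH MULTIPLICITY `(Σ_e χ⁰_i(e)·Σ_{M ∈ 𝒯·M₀} #{a : diag(ϖ^{a})·M is a type-tv vertex of diag(c^{e})}) · [𝒰 : S_F(M₀)] = 8 · [𝒯 : S̃(M₀)] · Σ_{cosets D·S_F of Δ_tv(M₀)} cosetKappa σ i (D·S_F)`

Cell `hodgecm-mathlib` (D-0151), FLOOR 0, crux item H413 = `stmt-HodgeConjecture-24833`, route of record `HCCMUnconditional`; squad F0∕P3c∕LH4 (req618∕req620); registered stub served:
`F0P3cDyRamFourFrameU3.stub_U3_kappaModelSum` ∕ `…kappaSignModelSum` (tree U3 ED. 7 :407 ∕ :449) through their child (κ-A₂) `stub_U3_kappaStageA_typeTwo_mult` of the U3 ED. 9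
«κ-SPLIT».  THEOREMS ONLY (no `def`, no instance, no notation, no `sorry`); lane `--supports stmt-HodgeConjecture-24833` (count-neutral).

THE MATHEMATICS = LH4-p14 (g2)'s (O2b)-MULT double count on `Ω = {(diag(u)·M₀, N(u)·S_F)}` (M2, steps 1, 3–5 VERBATIM over ★ M1's slice counts) with the class
weight `χ⁰_i(e)` carried along: for `F_i(M) = Σ_e χ⁰_i(e)·#{a : diag(ϖu^{a})·M type-tv for diag(d_e)}` and representatives `reps` of the `S_F(M₀)`-cosets of type-tv
polarisations (`hΔ`, `hfree`): (a) `Σ_{ω ∈ Ω} F_i(ω.1) = (Σ_{𝒯·M₀} F_i)·[S̃ : S̃ ∩ H]`; (b) `Σ_{ω ∈ Ω} F_i(ω.1) = Σ_{(e, D)} χ⁰_i(e)·#{ω ∈ Ω : ω.2 = κ(e, D)} = [H : S̃ ∩ H]·Σ_{D}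
Σ_{e good_D} χ⁰_i(e)` and, per representative, this seat's ★ `sum_signChar_filter_good_eq_card_mul_cosetKappa`: `Σ_{e good_D} χ⁰_i(e) = m·cosetKappa σ i (D·S_F)`
(`m = [N𝒯·S_F : N𝒯]` for every `D`); (c) M1's index identities in `ℚ`.  NO one-coset hypothesis, NO `N(S̃) ≤ S_F`.  With `reps` chosen from ★ `polarisationCosets` the
right-hand sum IS `kappaCount σ ϖ tv i M₀` (follow-up `…KappaOrbitCountMult`, paying (κ-A₂) via this seat's ★ signed averaging engine).

WHAT IS PROVED (`N = 3`, `K : Type`): `sum_signChar_mul_finsum_ncard_fibre_mul_relIndex_eq_mul_sum_cosetKappa` — the identity of the title over `ℚ`, for every `M₀` with finite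
orbit and every finite disjoint coset description `reps` of its type-`tv` polarisations.
HONEST LABEL.  Count-neutral (`--supports`); nothing printed is asserted; (KMS)∕(KSS) stay PROVER TARGETS; `HC_CM` is proved only modulo the 7 printed citations (2 remaining named
inputs: hLiu418 = `stmt-HodgeConjecture-24832`, h413 = `stmt-HodgeConjecture-24833`) until rung 0 closes.

## References
* [Kottwitz1986BaseChangeUnits] R. E. Kottwitz, *Base change for unit elements of Hecke algebras*, Compositio Math. 60 (1986), §1 pp. 240–241.
* [Rogawski1990] J. D. Rogawski, *Automorphic Representations of Unitary Groups in Three Variables*, Ann. of Math. Stud. 123 (1990), §4.9 Prop. 4.9.1 (a) p. 55, §4.10 p. 58.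
* [LanglandsShelstad1987] R. P. Langlands, D. Shelstad, *On the definition of transfer factors*, Math. Ann. 278 (1987), §3.
-/

set_option autoImplicit false

noncomputable section

namespace Summit.HodgeConjecture.HodgeConjecture.Cruxes.H413.F0P3cDyRamDiagonalKappaOrbitFibreCountMult

open Matrix
open Literature.NumberTheory.Automorphic Literature.NumberTheory.Automorphic.HermitianLattice
open Literature.NumberTheory.Automorphic.UnitaryLatticeTree Literature.NumberTheory.Automorphic.UnitaryThreeFourFrame
open Summit.HodgeConjecture.HodgeConjecture.Cruxes.H413.F0P3cDyRamDiagonalTorusDefs Summit.HodgeConjecture.HodgeConjecture.Cruxes.H413.F0P3cDyRamDiagonalOrbitFibreTransport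
open Summit.HodgeConjecture.HodgeConjecture.Cruxes.H413.F0P3cDyRamTorusRepresentativesCount Summit.HodgeConjecture.HodgeConjecture.Cruxes.H413.F0P3cDyRamDiagonalPairReindex
open Summit.HodgeConjecture.HodgeConjecture.Cruxes.H413.F0P3cDyRamDiagonalOrbitFibreCount
open Summit.HodgeConjecture.HodgeConjecture.Cruxes.H413.F0P3cDyRamDiagonalOrbitAveraging (relIndex_fixedUnitStabilizer_ne_zero_of_finite)
open Summit.HodgeConjecture.HodgeConjecture.Cruxes.H413.F0P3cDyRamDiagonalOrbitFibreCountMult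
open Summit.HodgeConjecture.HodgeConjecture.Cruxes.H413.F0P3cDyRamDiagonalKappaCountDefs Summit.HodgeConjecture.HodgeConjecture.Cruxes.H413.F0P3cDyRamDiagonalKappaCountEval
open Summit.HodgeConjecture.HodgeConjecture.Cruxes.H413.F0P3cDyRamDiagonalKappaOrbitFibreCount
open scoped Valued WithZero Matrix MatrixGroups

variable {K : Type} [Field K] [Valued K ℤᵐ⁰]

open Classical in
/-- **(Oκ2b)-MULT · THE κ-TWISTED FIBRE COUNT ALONG A UNIT-TORUS ORBIT WITH MULTIPLICITY** (hypotheses of ★ M2 `finsum_ncard_fibre_mul_relIndex_eq_mul_card` + a slot `i`):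
`(Σ_e χ⁰_i(e) · Σᶠ_{M ∈ 𝒯·M₀} #{a : diag(ϖu^{a})·M is a type-tv vertex of diag(d_e)}) · [𝒰 : S_F(M₀)] = 8 · [𝒯 : S̃(M₀)] · Σ_{D ∈ reps} cosetKappa σ i (D·S_F(M₀))` over `ℚ`.
No one-coset hypothesis ((R-21) currency). [cite: Kottwitz1986BaseChangeUnits, §1 pp. 240–241] [cite: Rogawski1990, §4.9 Prop. 4.9.1 (a) p. 55] [cite: LanglandsShelstad1987, §3] -/
theorem sum_signChar_mul_finsum_ncard_fibre_mul_relIndex_eq_mul_sum_cosetKappa {σ : K →+* K} (hσ : ∀ x, σ (σ x) = x) (hvσ : ∀ a, Valued.v (σ a) = Valued.v a)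
    {ϖ : K} (hϖ : Valued.v ϖ = WithZero.exp (-1 : ℤ)) (ϖu : Kˣ) (hϖu : (ϖu : K) = ϖ)
    {c : K} (hσc : σ c = c) (hcv : Valued.v c = 1) (hc : ¬ ∃ z : K, z * σ z = c)
    (hdich : ∀ x : K, σ x = x → x ≠ 0 → (∃ z : K, z * σ z = x) ∨ ∃ z : K, z * σ z = c * x)
    {M₀ : Submodule 𝒪[K] (Fin 3 → K)}
    (hfin : {M : Submodule 𝒪[K] (Fin 3 → K) | ∃ u ∈ unitTorus K 3, M = mapGL (diagGLUnits u) M₀}.Finite) (tv : ℕ)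
    (reps : Finset (Fin 3 → K)) (hrepsfix : ∀ D ∈ reps, ∀ i, σ (D i) = D i ∧ D i ≠ 0)
    (hΔ : ∀ D : Fin 3 → K, (∀ i, σ (D i) = D i ∧ D i ≠ 0) →
      (IsVertexLattice σ ϖ (Matrix.diagonal D) tv M₀ ↔ ∃ D₁ ∈ reps, ∃ u ∈ fixedUnitStabilizer σ M₀, ∀ i, D i = D₁ i * (u i : Kˣ)))
    (hfree : ∀ D₁ ∈ reps, ∀ D₂ ∈ reps, ∀ u ∈ fixedUnitStabilizer σ M₀, (∀ i, D₂ i = D₁ i * (u i : Kˣ)) → D₁ = D₂) (i : Fin 3) :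
    (∑ e : Fin 3 → Bool, (signChar i e : ℚ) *
        ((∑ᶠ M ∈ {M : Submodule 𝒪[K] (Fin 3 → K) | ∃ u ∈ unitTorus K 3, M = mapGL (diagGLUnits u) M₀},
          ({a : Fin 3 → ℤ | IsVertexLattice σ ϖ (Matrix.diagonal fun j => if e j then c else (1 : K)) tv
            (mapGL (diagGLUnits fun j => ϖu ^ a j) M)} : Set _).ncard : ℕ) : ℚ)) *
      (((fixedUnitStabilizer σ M₀).relIndex (fixedUnitTorus σ 3) : ℕ) : ℚ) =
    8 * (((unitStabilizer M₀).relIndex (unitTorus K 3) : ℕ) : ℚ) *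
      ∑ D ∈ reps, (cosetKappa σ i {D' : Fin 3 → K | ∃ u ∈ fixedUnitStabilizer σ M₀, ∀ j, D' j = D j * ((u j : Kˣ) : K)} : ℚ) := by
  classical
  have hc0 : c ≠ 0 := fun h => by simp [h] at hcv
  have upi : ∀ {x y : Fin 3 → Kˣ}, (∀ i, ((x i : Kˣ) : K) = y i) → x = y := fun h => funext fun i => Units.ext (h i)
  set cU : Kˣ := Units.mk0 c hc0 with hcUdef
  have hcU : (cU : K) = c := rfl
  set cvec : (Fin 3 → Bool) → (Fin 3 → Kˣ) := fun e i => if e i then cU else 1 with hcvec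
  have hcvec_val : ∀ e i, ((cvec e i : Kˣ) : K) = if e i then c else 1 := by
    intro e i; by_cases h : e i <;> simp [hcvec, h, hcU]
  have hcvec_ne : ∀ (e : Fin 3 → Bool) i, (if e i then c else (1 : K)) ≠ 0 := by
    intro e i; by_cases h : e i <;> simp [h, hc0]
  have hcvec_v : ∀ (e : Fin 3 → Bool) i, Valued.v (if e i then c else (1 : K)) = 1 := by
    intro e i; by_cases h : e i <;> simp [h, hcv]
  have hcvec_fix : ∀ (e : Fin 3 → Bool) i, σ (if e i then c else (1 : K)) = if e i then c else 1 := by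
    intro e i; by_cases h : e i <;> simp [h, hσc]
  have hcvecU : ∀ e, cvec e ∈ fixedUnitTorus σ 3 := by
    intro e
    rw [mem_fixedUnitTorus_iff]
    exact ⟨fun i => by rw [hcvec_val]; exact hcvec_v e i, fun i => by rw [hcvec_val]; exact hcvec_fix e i⟩
  have hNT : (unitTorus K 3).map (unitNormMap σ 3) ≤ fixedUnitTorus σ 3 := map_unitNormMap_unitTorus_le hσ hvσ
  choose! aOf wOf hwU hDw using fun (D : Fin 3 → K) (hD : D ∈ reps) =>
    exists_zpow_fixedUnit_decomposition hσ hvσ hϖ ϖu hϖu hσc hcv hdich D (hrepsfix D hD)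
  -- Step 1: the fibre along `diag(u)·M₀`: `(e, b)` is in it iff for some representative `D`, `b = a_D` and `c^e·N(u)·w_D⁻¹ ∈ S_F`
  have step1 : ∀ u ∈ unitTorus K 3, ∀ (e : Fin 3 → Bool) (b : Fin 3 → ℤ),
      IsVertexLattice σ ϖ (Matrix.diagonal fun i => if e i then c else (1 : K)) tv
          (mapGL (diagGLUnits fun i => ϖu ^ b i) (mapGL (diagGLUnits u) M₀)) ↔
        ∃ D ∈ reps, b = aOf D ∧ cvec e * unitNormMap σ 3 u * (wOf D)⁻¹ ∈ fixedUnitStabilizer σ M₀ := by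
    intro u hu e b
    rw [← mapGL_mul, ← map_mul, isVertexLattice_diagonal_mapGL_diagGLUnits_iff]
    have hDfix : ∀ i, σ ((if e i then c else (1 : K)) * ((((fun j => ϖu ^ b j) * u) i : Kˣ) * σ (((fun j => ϖu ^ b j) * u) i : Kˣ)))
        = (if e i then c else (1 : K)) * ((((fun j => ϖu ^ b j) * u) i : Kˣ) * σ (((fun j => ϖu ^ b j) * u) i : Kˣ)) ∧
        (if e i then c else (1 : K)) * ((((fun j => ϖu ^ b j) * u) i : Kˣ) * σ (((fun j => ϖu ^ b j) * u) i : Kˣ)) ≠ 0 := fun i =>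
      ⟨by rw [map_mul, map_mul, hcvec_fix, hσ, mul_comm (σ _) (_ : K)],
        mul_ne_zero (hcvec_ne e i) (mul_ne_zero (Units.ne_zero _) ((map_ne_zero σ).2 (Units.ne_zero _)))⟩
    rw [hΔ _ hDfix]
    refine exists_congr fun D => and_congr_right fun hD => ?_
    have hwU' := (mem_fixedUnitTorus_iff σ (wOf D)).1 (hwU D hD)
    have key : ∀ s : Fin 3 → Kˣ, (∀ i, (if e i then c else (1 : K)) * ((((fun j => ϖu ^ b j) * u) i : Kˣ) * σ (((fun j => ϖu ^ b j) * u) i : Kˣ))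
          = D i * (s i : Kˣ)) ↔
        unitNormMap σ 3 (fun j => ϖu ^ b j) * (cvec e * unitNormMap σ 3 u) = unitNormMap σ 3 (fun j => ϖu ^ aOf D j) * (wOf D * s) := by
      intro s
      constructor
      · intro h
        refine upi fun i => ?_
        have := h i
        rw [hDw D hD i, unitNormMap_apply, Pi.mul_apply, Units.val_mul, map_mul] at this
        simp only [Pi.mul_apply, Units.val_mul, unitNormMap_apply, hcvec_val]
        linear_combination this
      · intro h i
        have := congrArg (fun f : Fin 3 → Kˣ => ((f i : Kˣ) : K)) h
        simp only [Pi.mul_apply, Units.val_mul, unitNormMap_apply, hcvec_val] at this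
        rw [hDw D hD i, unitNormMap_apply, Pi.mul_apply, Units.val_mul, map_mul]
        linear_combination this
    constructor
    · rintro ⟨s, hsSF, hs⟩
      rw [key] at hs
      have hsU := ((mem_fixedUnitStabilizer_iff σ M₀ s).1 hsSF).2.1
      have hb : b = aOf D := by
        funext i
        have := congrArg (fun f : Fin 3 → Kˣ => Valued.v ((f i : Kˣ) : K)) hs
        simp only [Pi.mul_apply, Units.val_mul, map_mul] at this
        rw [hcvec_val, hcvec_v, v_unitNormMap_zpow hvσ hϖ ϖu hϖu, v_unitNormMap_of_mem_unitTorus hvσ hu,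
          v_unitNormMap_zpow hvσ hϖ ϖu hϖu, hwU'.1 i, hsU i] at this
        simp only [mul_one, WithZero.exp_inj] at this
        omega
      subst hb
      refine ⟨rfl, ?_⟩
      have hs2 : cvec e * unitNormMap σ 3 u = wOf D * s := mul_left_cancel hs
      rw [hs2, mul_inv_cancel_comm]
      exact hsSF
    · rintro ⟨rfl, hmem⟩
      refine ⟨cvec e * unitNormMap σ 3 u * (wOf D)⁻¹, hmem, ?_⟩
      rw [key, mul_inv_cancel_comm_assoc]
  set φ : (Fin 3 → Kˣ) →* (Fin 3 → Kˣ) ⧸ fixedUnitStabilizer σ M₀ :=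
    (QuotientGroup.mk' (fixedUnitStabilizer σ M₀)).comp (unitNormMap σ 3) with hφ
  have hφeq : ∀ u y : Fin 3 → Kˣ, φ u = QuotientGroup.mk' (fixedUnitStabilizer σ M₀) y ↔
      (unitNormMap σ 3 u)⁻¹ * y ∈ fixedUnitStabilizer σ M₀ := by
    intro u y
    rw [hφ, MonoidHom.comp_apply, QuotientGroup.mk'_apply, QuotientGroup.mk'_apply, QuotientGroup.eq]
  set κ : (Fin 3 → Bool) × (Fin 3 → K) → (Fin 3 → Kˣ) ⧸ fixedUnitStabilizer σ M₀ :=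
    fun q => QuotientGroup.mk' (fixedUnitStabilizer σ M₀) (wOf q.2 * (cvec q.1)⁻¹) with hκ
  have hcond : ∀ (u : Fin 3 → Kˣ) (e : Fin 3 → Bool) (D : Fin 3 → K),
      cvec e * unitNormMap σ 3 u * (wOf D)⁻¹ ∈ fixedUnitStabilizer σ M₀ ↔ φ u = κ (e, D) := by
    intro u e D
    simp only [hκ]
    rw [hφeq]
    have hid : (unitNormMap σ 3 u)⁻¹ * (wOf D * (cvec e)⁻¹) = (cvec e * unitNormMap σ 3 u * (wOf D)⁻¹)⁻¹ := by
      refine upi fun i => ?_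
      simp only [Pi.mul_apply, Pi.inv_apply, Units.val_mul, Units.val_inv_eq_inv_val]
      field_simp
    rw [hid, inv_mem_iff]
  -- Step 2: the class-`e` fibre over `diag(u)·M₀` in `D`-currency, and the signed fibre count `F`
  set Orb : Set (Submodule 𝒪[K] (Fin 3 → K)) := {M | ∃ u ∈ unitTorus K 3, M = mapGL (diagGLUnits u) M₀} with hOrb
  set A : (Fin 3 → Bool) → Submodule 𝒪[K] (Fin 3 → K) → Set (Fin 3 → ℤ) := fun e M =>
    {a | IsVertexLattice σ ϖ (Matrix.diagonal fun j => if e j then c else (1 : K)) tv (mapGL (diagGLUnits fun j => ϖu ^ a j) M)} with hA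
  have hAF : ∀ u ∈ unitTorus K 3, ∀ e, A e (mapGL (diagGLUnits u) M₀) = ↑((reps.filter fun D => φ u = κ (e, D)).image aOf) := by
    intro u hu e
    ext a
    rw [Finset.coe_image, Set.mem_image]
    constructor
    · intro ha
      obtain ⟨D, hD, hb, hmem⟩ := (step1 u hu e a).1 ha
      refine ⟨D, ?_, hb.symm⟩
      rw [Finset.mem_coe, Finset.mem_filter]
      exact ⟨hD, (hcond u e D).1 hmem⟩
    · rintro ⟨D, hD, rfl⟩
      rw [Finset.mem_coe, Finset.mem_filter] at hD
      exact (step1 u hu e (aOf D)).2 ⟨D, hD.1, rfl, (hcond u e D).2 hD.2⟩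
  have hinjOn : ∀ u ∈ unitTorus K 3, ∀ e, Set.InjOn aOf ↑(reps.filter fun D => φ u = κ (e, D)) := by
    intro u hu e D₁ hD₁ D₂ hD₂ hb
    rw [Finset.mem_coe, Finset.mem_filter] at hD₁ hD₂
    have h1 := (hcond u e D₁).2 hD₁.2
    have h2 := (hcond u e D₂).2 hD₂.2
    have hs : wOf D₁ * (wOf D₂)⁻¹ ∈ fixedUnitStabilizer σ M₀ := by
      have := (fixedUnitStabilizer σ M₀).mul_mem ((fixedUnitStabilizer σ M₀).inv_mem h1) h2
      have hid : (cvec e * unitNormMap σ 3 u * (wOf D₁)⁻¹)⁻¹ * (cvec e * unitNormMap σ 3 u * (wOf D₂)⁻¹) = wOf D₁ * (wOf D₂)⁻¹ := by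
        refine upi fun i => ?_
        simp only [Pi.mul_apply, Pi.inv_apply, Units.val_mul, Units.val_inv_eq_inv_val]
        field_simp
      rwa [hid] at this
    refine hfree D₁ hD₁.1 D₂ hD₂.1 (wOf D₁ * (wOf D₂)⁻¹)⁻¹ ((fixedUnitStabilizer σ M₀).inv_mem hs) fun i => ?_
    rw [hDw D₂ hD₂.1 i, hDw D₁ hD₁.1 i, show aOf D₁ = aOf D₂ from hb]
    simp only [Pi.mul_apply, Pi.inv_apply, Units.val_mul, Units.val_inv_eq_inv_val]
    field_simp
  have hAcard : ∀ u ∈ unitTorus K 3, ∀ e, (A e (mapGL (diagGLUnits u) M₀)).ncard = (reps.filter fun D => φ u = κ (e, D)).card := by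
    intro u hu e
    rw [hAF u hu e, Set.ncard_coe_finset, Finset.card_image_of_injOn (hinjOn u hu e)]
  set F : Submodule 𝒪[K] (Fin 3 → K) → ℚ := fun M => ∑ e : Fin 3 → Bool, (signChar i e : ℚ) * ((A e M).ncard : ℚ) with hF
  have hFq : ∀ u ∈ unitTorus K 3, F (mapGL (diagGLUnits u) M₀) =
      ∑ q ∈ (Finset.univ ×ˢ reps).filter (fun q : (Fin 3 → Bool) × (Fin 3 → K) => φ u = κ q), (signChar i q.1 : ℚ) := by
    intro u hu
    simp only [hF, hAcard u hu, Finset.card_eq_sum_ones, Nat.cast_sum, Nat.cast_one, Finset.mul_sum, mul_one]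
    rw [Finset.sum_filter, Finset.sum_product]
    refine Finset.sum_congr rfl fun e _ => ?_
    rw [Finset.sum_filter]
  -- Step 3: the subgroup `X = N⁻¹S_F`, the eight classes, non-vanishing indices
  set X : Subgroup (Fin 3 → Kˣ) := (fixedUnitStabilizer σ M₀).comap (unitNormMap σ 3) with hX
  have hkerφ : φ.ker = X := by rw [hφ, ← MonoidHom.comap_ker, QuotientGroup.ker_mk']
  have hrep : ∀ x ∈ fixedUnitTorus σ 3, ∃! e : Fin 3 → Bool, x * (cvec e)⁻¹ ∈ (unitTorus K 3).map (unitNormMap σ 3) :=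
    fun x hx => existsUnique_signVector_mem_map_unitNormMap hvσ hσc hcv hc hdich cU hcU x hx
  have h8 : ((unitTorus K 3).map (unitNormMap σ 3)).relIndex (fixedUnitTorus σ 3) = 8 :=
    relIndex_map_unitNormMap_unitTorus_eq_eight hσ hvσ hσc hcv hc hdich
  have hSF0 : (fixedUnitStabilizer σ M₀).relIndex (fixedUnitTorus σ 3) ≠ 0 := relIndex_fixedUnitStabilizer_ne_zero_of_finite σ hfin
  have hE := relIndex_map_sup_mul_relIndex_eq (unitTorus K 3) (fixedUnitTorus σ 3) (latticeStabilizer M₀) (unitNormMap σ 3) hNT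
  rw [h8] at hE
  change ((unitTorus K 3).map (unitNormMap σ 3)).relIndex ((unitTorus K 3).map (unitNormMap σ 3) ⊔ latticeStabilizer M₀ ⊓ fixedUnitTorus σ 3) *
      (fixedUnitStabilizer σ M₀).relIndex (fixedUnitTorus σ 3) = 8 * (unitTorus K 3 ⊓ X).relIndex (unitTorus K 3) at hE
  rw [Subgroup.inf_relIndex_left] at hE
  set m : ℕ := ((unitTorus K 3).map (unitNormMap σ 3)).relIndex ((unitTorus K 3).map (unitNormMap σ 3) ⊔ latticeStabilizer M₀ ⊓ fixedUnitTorus σ 3) with hm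
  have hm0 : m ≠ 0 := fun h0 => by
    have := Subgroup.relIndex_eq_zero_of_le_right (H := (unitTorus K 3).map (unitNormMap σ 3))
      (sup_le hNT inf_le_right : (unitTorus K 3).map (unitNormMap σ 3) ⊔ latticeStabilizer M₀ ⊓ fixedUnitTorus σ 3 ≤ fixedUnitTorus σ 3) h0
    rw [h8] at this
    exact absurd this (by norm_num)
  have hXT0 : X.relIndex (unitTorus K 3) ≠ 0 := by
    intro h0
    rw [h0, mul_zero] at hE
    rcases mul_eq_zero.1 hE with h | h
    · exact hm0 h
    · exact hSF0 h
  have hST : unitStabilizer M₀ ≤ unitTorus K 3 := fun x hx => (Subgroup.mem_inf.1 hx).2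
  have hXS0 : X.relIndex (unitStabilizer M₀) ≠ 0 := fun h0 => hXT0 (Subgroup.relIndex_eq_zero_of_le_right hST h0)
  -- Step 4: `Ω`, its slices over lattices and over classes
  set Ω : Set (Submodule 𝒪[K] (Fin 3 → K) × ((Fin 3 → Kˣ) ⧸ fixedUnitStabilizer σ M₀)) :=
    {ω | ∃ u ∈ unitTorus K 3, ω = (mapGL (diagGLUnits u) M₀, φ u)} with hΩ
  set slice : Submodule 𝒪[K] (Fin 3 → K) → Set ((Fin 3 → Kˣ) ⧸ fixedUnitStabilizer σ M₀) := fun M => {θ | (M, θ) ∈ Ω} with hslice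
  have hΩOrb : ∀ (M : Submodule 𝒪[K] (Fin 3 → K)) (θ : (Fin 3 → Kˣ) ⧸ fixedUnitStabilizer σ M₀), (M, θ) ∈ Ω → M ∈ Orb := by
    rintro M θ ⟨u, hu, h⟩
    exact ⟨u, hu, (Prod.mk.inj h).1⟩
  have hslicecard : ∀ u ∈ unitTorus K 3, (slice (mapGL (diagGLUnits u) M₀)).ncard = X.relIndex (unitStabilizer M₀) := fun u hu =>
    ncard_normClasses_over_lattice_eq σ M₀ u hu
  have hslicefin : ∀ u ∈ unitTorus K 3, (slice (mapGL (diagGLUnits u) M₀)).Finite := fun u hu =>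
    Set.finite_of_ncard_ne_zero (by rw [hslicecard u hu]; exact hXS0)
  have hclass : ∀ y : Fin 3 → Kˣ, {ω ∈ Ω | ω.2 = QuotientGroup.mk' (fixedUnitStabilizer σ M₀) y}.ncard =
      if ∃ u₀ ∈ unitTorus K 3, (unitNormMap σ 3 u₀)⁻¹ * y ∈ fixedUnitStabilizer σ M₀
      then (latticeStabilizer M₀).relIndex (unitTorus K 3 ⊓ X) else 0 := fun y =>
    ncard_lattices_over_class_eq σ M₀ y
  -- Step 5: which classes `κ(e, D)` are occupied, and how many `e` per representative (★ PART 1)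
  have hgood_iff : ∀ (e : Fin 3 → Bool) (D : Fin 3 → K),
      (∃ u₀ ∈ unitTorus K 3, (unitNormMap σ 3 u₀)⁻¹ * (wOf D * (cvec e)⁻¹) ∈ fixedUnitStabilizer σ M₀) ↔
        (wOf D)⁻¹ * cvec e ∈ (unitTorus K 3).map (unitNormMap σ 3) ⊔ latticeStabilizer M₀ ⊓ fixedUnitTorus σ 3 := fun e D =>
    exists_inv_unitNormMap_mul_mem_iff σ M₀ (wOf D) (cvec e)
  have hgood_card : ∀ D ∈ reps, (Finset.univ.filter fun e : Fin 3 → Bool =>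
        ∃ u₀ ∈ unitTorus K 3, (unitNormMap σ 3 u₀)⁻¹ * (wOf D * (cvec e)⁻¹) ∈ fixedUnitStabilizer σ M₀).card = m := by
    intro D hD
    have hXU : (unitTorus K 3).map (unitNormMap σ 3) ⊔ latticeStabilizer M₀ ⊓ fixedUnitTorus σ 3 ≤ fixedUnitTorus σ 3 := sup_le hNT inf_le_right
    rw [hm, ← card_filter_mem_coset_eq_relIndex ((unitTorus K 3).map (unitNormMap σ 3)) _ (fixedUnitTorus σ 3) le_sup_left hXU cvec hcvecU hrep
      (wOf D) (hwU D hD)]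
    congr 1
    ext e
    simp only [Finset.mem_filter, Finset.mem_univ, true_and]
    exact hgood_iff e D
  have hinner : ∀ D ∈ reps, ∑ e : Fin 3 → Bool, {ω ∈ Ω | ω.2 = κ (e, D)}.ncard = m * (latticeStabilizer M₀).relIndex (unitTorus K 3 ⊓ X) := by
    intro D hD
    have hterm : ∀ e : Fin 3 → Bool, {ω ∈ Ω | ω.2 = κ (e, D)}.ncard =
        if ∃ u₀ ∈ unitTorus K 3, (unitNormMap σ 3 u₀)⁻¹ * (wOf D * (cvec e)⁻¹) ∈ fixedUnitStabilizer σ M₀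
        then (latticeStabilizer M₀).relIndex (unitTorus K 3 ⊓ X) else 0 := fun e => by
      simp only [hκ]
      exact hclass _
    rw [Finset.sum_congr rfl fun e _ => hterm e, Finset.sum_ite, Finset.sum_const_zero, add_zero, Finset.sum_const, smul_eq_mul,
      hgood_card D hD]
  -- Step 6: the double count of `Σ_{ω ∈ Ω} #fibre(ω.1)`
  have hΩsub : Ω ⊆ Orb ×ˢ (φ '' (unitTorus K 3 : Set (Fin 3 → Kˣ))) := by
    rintro ω ⟨u, hu, rfl⟩
    exact Set.mk_mem_prod ⟨u, hu, rfl⟩ ⟨u, hu, rfl⟩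
  have hφTcard : (φ '' (unitTorus K 3 : Set (Fin 3 → Kˣ))).ncard = X.relIndex (unitTorus K 3) := by
    rw [← hkerφ, Subgroup.relIndex_ker]
    exact (Nat.card_coe_set_eq _).symm
  have hΩfin : Ω.Finite := (hfin.prod (Set.finite_of_ncard_ne_zero (by rw [hφTcard]; exact hXT0))).subset hΩsub
  set Ωf := hΩfin.toFinset with hΩf
  have hmemΩf : ∀ ω, ω ∈ Ωf ↔ ω ∈ Ω := fun ω => Set.Finite.mem_toFinset hΩfin
  -- (a) over lattices: `Σ_{ω ∈ Ω} F(ω.1) = (Σᶠ_{Orb} F) · X.relIndex S̃`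
  have hA1 : ∑ ω ∈ Ωf, F ω.1 = ∑ M ∈ hfin.toFinset, ((Ωf.filter fun ω => ω.1 = M).card : ℚ) * F M := by
    rw [Finset.sum_comp (s := Ωf) (f := F) (g := Prod.fst)]
    have himg : Ωf.image Prod.fst = hfin.toFinset := by
      ext M
      simp only [Finset.mem_image, hmemΩf, Set.Finite.mem_toFinset]
      constructor
      · rintro ⟨ω, hω, rfl⟩
        exact hΩOrb ω.1 ω.2 (by rw [Prod.mk.eta]; exact hω)
      · rintro ⟨u, hu, rfl⟩
        exact ⟨(mapGL (diagGLUnits u) M₀, φ u), ⟨u, hu, rfl⟩, rfl⟩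
    rw [himg]
    refine Finset.sum_congr rfl fun M _ => ?_
    rw [nsmul_eq_mul]
  have hA2 : ∀ u ∈ unitTorus K 3, ((Ωf.filter fun ω => ω.1 = mapGL (diagGLUnits u) M₀).card : ℚ) = ((X.relIndex (unitStabilizer M₀) : ℕ) : ℚ) := by
    intro u hu
    rw [← hslicecard u hu, Set.ncard_eq_toFinset_card _ (hslicefin u hu)]
    congr 1
    refine Finset.card_bij (fun ω _ => ω.2) ?_ ?_ ?_
    · intro ω hω
      rw [Finset.mem_filter, hmemΩf] at hω
      rw [Set.Finite.mem_toFinset]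
      show (mapGL (diagGLUnits u) M₀, ω.2) ∈ Ω
      rw [← hω.2]; exact hω.1
    · intro ω hω ω' hω' h
      rw [Finset.mem_filter] at hω hω'
      exact Prod.ext (hω.2.trans hω'.2.symm) h
    · intro θ hθ
      rw [Set.Finite.mem_toFinset] at hθ
      exact ⟨(mapGL (diagGLUnits u) M₀, θ), by rw [Finset.mem_filter, hmemΩf]; exact ⟨hθ, rfl⟩, rfl⟩
  have hA : ∑ ω ∈ Ωf, F ω.1 = (∑ᶠ M ∈ Orb, F M) * ((X.relIndex (unitStabilizer M₀) : ℕ) : ℚ) := by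
    rw [hA1, finsum_mem_eq_finite_toFinset_sum _ hfin, Finset.sum_mul]
    refine Finset.sum_congr rfl fun M hM => ?_
    obtain ⟨u, hu, rfl⟩ := (Set.Finite.mem_toFinset hfin).1 hM
    rw [hA2 u hu, mul_comm]
  -- (b) over classes: `Σ_{ω ∈ Ω} F(ω.1) = Σ_{(e, D)} χ⁰_i(e) · #{ω ∈ Ω : ω.2 = κ(e, D)} = [lS : 𝒯 ⊓ X] · m · Σ_D cosetKappa_D`
  have hB1 : ∑ ω ∈ Ωf, F ω.1 = ∑ ω ∈ Ωf, ∑ q ∈ (Finset.univ ×ˢ reps).filter (fun q : (Fin 3 → Bool) × (Fin 3 → K) => ω.2 = κ q), (signChar i q.1 : ℚ) := by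
    refine Finset.sum_congr rfl fun ω hω => ?_
    obtain ⟨u, hu, rfl⟩ := (hmemΩf ω).1 hω
    exact hFq u hu
  have hB2 : ∑ ω ∈ Ωf, ∑ q ∈ (Finset.univ ×ˢ reps).filter (fun q : (Fin 3 → Bool) × (Fin 3 → K) => ω.2 = κ q), (signChar i q.1 : ℚ) =
      ∑ q ∈ Finset.univ ×ˢ reps, (signChar i q.1 : ℚ) * (({ω ∈ Ω | ω.2 = κ q}.ncard : ℕ) : ℚ) := by
    rw [Finset.sum_congr rfl fun ω _ => Finset.sum_filter _ _, Finset.sum_comm]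
    refine Finset.sum_congr rfl fun q _ => ?_
    rw [← Finset.sum_filter, Finset.sum_const, nsmul_eq_mul, mul_comm]
    congr 2
    rw [Set.ncard_eq_toFinset_card _ (hΩfin.subset (Set.sep_subset _ _))]
    congr 1
    ext ω
    simp only [Finset.mem_filter, hmemΩf, Set.Finite.mem_toFinset, Set.mem_setOf_eq]
  have hinnerκ : ∀ D ∈ reps, ∑ e : Fin 3 → Bool, (signChar i e : ℚ) * (({ω ∈ Ω | ω.2 = κ (e, D)}.ncard : ℕ) : ℚ) =
      (((latticeStabilizer M₀).relIndex (unitTorus K 3 ⊓ X) : ℕ) : ℚ) * ((m : ℚ) *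
        (cosetKappa σ i {D' : Fin 3 → K | ∃ u ∈ fixedUnitStabilizer σ M₀, ∀ j, D' j = D j * ((u j : Kˣ) : K)} : ℚ)) := by
    intro D hD
    have hterm : ∀ e : Fin 3 → Bool, (({ω ∈ Ω | ω.2 = κ (e, D)}.ncard : ℕ) : ℚ) =
        if (wOf D)⁻¹ * cvec e ∈ (unitTorus K 3).map (unitNormMap σ 3) ⊔ latticeStabilizer M₀ ⊓ fixedUnitTorus σ 3
        then (((latticeStabilizer M₀).relIndex (unitTorus K 3 ⊓ X) : ℕ) : ℚ) else 0 := fun e => by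
      simp only [hκ]
      rw [hclass, if_congr (hgood_iff e D) rfl rfl]
      split_ifs <;> simp
    have hsumχ : ∑ e ∈ Finset.univ.filter (fun e : Fin 3 → Bool =>
        (wOf D)⁻¹ * cvec e ∈ (unitTorus K 3).map (unitNormMap σ 3) ⊔ latticeStabilizer M₀ ⊓ fixedUnitTorus σ 3), (signChar i e : ℚ) =
        ((Finset.univ.filter fun e : Fin 3 → Bool =>
          (wOf D)⁻¹ * cvec e ∈ (unitTorus K 3).map (unitNormMap σ 3) ⊔ latticeStabilizer M₀ ⊓ fixedUnitTorus σ 3).card : ℚ) *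
        (cosetKappa σ i {D' : Fin 3 → K | ∃ u ∈ fixedUnitStabilizer σ M₀, ∀ j, D' j = D j * ((u j : Kˣ) : K)} : ℚ) :=
      sum_signChar_filter_good_eq_card_mul_cosetKappa hvσ ϖu hσc hcv hc hdich cU hcU M₀ (hrepsfix D hD) (hwU D hD) (hDw D hD) i
    have hcardm : ((Finset.univ.filter fun e : Fin 3 → Bool =>
        (wOf D)⁻¹ * cvec e ∈ (unitTorus K 3).map (unitNormMap σ 3) ⊔ latticeStabilizer M₀ ⊓ fixedUnitTorus σ 3).card : ℚ) = (m : ℚ) := by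
      rw [← hgood_card D hD]
      congr 2
      ext e
      simp only [Finset.mem_filter, Finset.mem_univ, true_and]
      exact (hgood_iff e D).symm
    simp_rw [hterm, mul_ite, mul_zero]
    rw [← Finset.sum_filter, ← Finset.sum_mul, hsumχ, hcardm]
    ring
  have hB3 : ∑ q ∈ Finset.univ ×ˢ reps, (signChar i q.1 : ℚ) * (({ω ∈ Ω | ω.2 = κ q}.ncard : ℕ) : ℚ) =
      (((latticeStabilizer M₀).relIndex (unitTorus K 3 ⊓ X) : ℕ) : ℚ) * ((m : ℚ) *
        ∑ D ∈ reps, (cosetKappa σ i {D' : Fin 3 → K | ∃ u ∈ fixedUnitStabilizer σ M₀, ∀ j, D' j = D j * ((u j : Kˣ) : K)} : ℚ)) := by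
    rw [Finset.sum_product_right, Finset.mul_sum, Finset.mul_sum]
    exact Finset.sum_congr rfl fun D hD => hinnerκ D hD
  have hC : (∑ᶠ M ∈ Orb, F M) * ((X.relIndex (unitStabilizer M₀) : ℕ) : ℚ) =
      (((latticeStabilizer M₀).relIndex (unitTorus K 3 ⊓ X) : ℕ) : ℚ) * ((m : ℚ) *
        ∑ D ∈ reps, (cosetKappa σ i {D' : Fin 3 → K | ∃ u ∈ fixedUnitStabilizer σ M₀, ∀ j, D' j = D j * ((u j : Kˣ) : K)} : ℚ)) := by
    rw [← hA, hB1, hB2, hB3]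
  -- (c) the left-hand side is `Σᶠ_{Orb} F` (finite sum over `e` and finsum over the orbit commute), then M1's index identities in `ℚ`
  have hswap : (∑ e : Fin 3 → Bool, (signChar i e : ℚ) * ((∑ᶠ M ∈ Orb, (A e M).ncard : ℕ) : ℚ)) = ∑ᶠ M ∈ Orb, F M := by
    rw [finsum_mem_eq_finite_toFinset_sum _ hfin]
    simp only [hF]
    rw [Finset.sum_comm]
    refine Finset.sum_congr rfl fun e _ => ?_
    rw [finsum_mem_eq_finite_toFinset_sum _ hfin, Nat.cast_sum, Finset.mul_sum]
  have hI : X.relIndex (unitStabilizer M₀) * (unitStabilizer M₀).relIndex (unitTorus K 3) =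
      (latticeStabilizer M₀).relIndex (unitTorus K 3 ⊓ X) * X.relIndex (unitTorus K 3) := relIndex_unitStabilizer_mul_relIndex_eq M₀ X
  have hIQ : ((X.relIndex (unitStabilizer M₀) : ℕ) : ℚ) * (((unitStabilizer M₀).relIndex (unitTorus K 3) : ℕ) : ℚ) =
      (((latticeStabilizer M₀).relIndex (unitTorus K 3 ⊓ X) : ℕ) : ℚ) * ((X.relIndex (unitTorus K 3) : ℕ) : ℚ) := by exact_mod_cast hI
  have hEQ : (m : ℚ) * (((fixedUnitStabilizer σ M₀).relIndex (fixedUnitTorus σ 3) : ℕ) : ℚ) = 8 * ((X.relIndex (unitTorus K 3) : ℕ) : ℚ) := by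
    exact_mod_cast hE
  have hXS0Q : ((X.relIndex (unitStabilizer M₀) : ℕ) : ℚ) ≠ 0 := Nat.cast_ne_zero.2 hXS0
  have hXT0Q : ((X.relIndex (unitTorus K 3) : ℕ) : ℚ) ≠ 0 := Nat.cast_ne_zero.2 hXT0
  rw [hswap]
  have hSum : (∑ᶠ M ∈ Orb, F M) = (((latticeStabilizer M₀).relIndex (unitTorus K 3 ⊓ X) : ℕ) : ℚ) * ((m : ℚ) *
      ∑ D ∈ reps, (cosetKappa σ i {D' : Fin 3 → K | ∃ u ∈ fixedUnitStabilizer σ M₀, ∀ j, D' j = D j * ((u j : Kˣ) : K)} : ℚ)) /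
        ((X.relIndex (unitStabilizer M₀) : ℕ) : ℚ) := by
    rw [eq_div_iff hXS0Q, hC]
  rw [hSum, div_mul_eq_mul_div, div_eq_iff hXS0Q]
  linear_combination ((((latticeStabilizer M₀).relIndex (unitTorus K 3 ⊓ X) : ℕ) : ℚ) *
      ∑ D ∈ reps, (cosetKappa σ i {D' : Fin 3 → K | ∃ u ∈ fixedUnitStabilizer σ M₀, ∀ j, D' j = D j * ((u j : Kˣ) : K)} : ℚ)) * hEQ -
    (8 * ∑ D ∈ reps, (cosetKappa σ i {D' : Fin 3 → K | ∃ u ∈ fixedUnitStabilizer σ M₀, ∀ j, D' j = D j * ((u j : Kˣ) : K)} : ℚ)) * hIQ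

end Summit.HodgeConjecture.HodgeConjecture.Cruxes.H413.F0P3cDyRamDiagonalKappaOrbitFibreCountMult
end
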